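import Summits.BirchSwinnertonDyer.BirchSwinnertonDyer.Theorems.ShaPrimaryTransferFiniteShaComponentTransferZywinaEqualityDoorClasses
import Summits.BirchSwinnertonDyer.BirchSwinnertonDyer.Theorems.ShaPrimaryTransferFiniteShaComponentTransferZywinaEqualityDoorDescent
import HarnessLib

/-!
# BirchSwinnertonDyer / ShaPrimaryTransfer — crux `FiniteShaComponentTransfer` (stmt-BirchSwinnertonDyer-22356):
# ALL KEYS OF THE `5`-ADIC DOOR on the classes `zywinaClass 5 K m₁ M` (THEOREM R* discharges Schneider)

Capstone of the companion files `…ZywinaEqualityDoor` (member door), `…Classes` (R* on the classes, infinitude mod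
Tao–Ziegler), `…Kato` (asymmetric budget), `…Infinite`, `…Descent` (descent currency).  On a member `E_{m,n}` of a class
`zywinaClass 5 K m₁ M` (`0 < K`, `5 ∤ m₁`, `5^K ∤ m₁⁴ − 1`, `7 ∣ M`), granting ONLY the two prints PRS 85 (`h85`) and
BCS (`hMC`) — no Schneider hypothesis (THEOREM R*), no Kato, no finiteness of `Ш`:
* the WINDOW `2 ≤ ord_{T=0} L_5(E_{m,n},T)` and the DOOR `ord_{T=0} L_5 = 2 ⟺ Ш(E_{m,n})[5^∞]` finite;
* the DESCENT side `25 ∣ #Sel^{(5)}(E_{m,n}/ℚ)` (unconditional) and the DESCENT KEY `#Sel^{(5)} = 25 ⟹ Ш[5^∞] = 0 ∧ ord L_5 = 2`;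
* `infinite_setOf_j_rankTwo_keys_five`: modulo Tao–Ziegler the set of `j`-invariants of rank-2 curves carrying all of
  the above is infinite (class `zywinaClass 5 2 11 7`).
So on an explicit infinite class of rank-2 curves the p-adic BSD inequality `rank ≤ ord L_p` is an equality EXACTLY when
`Ш[5^∞]` is finite, and ONE successful `5`-descent (`#Sel^{(5)} = 25`, a finite computation per member) opens the door.
Barrier B1 (`SelmerVersusMordellWeil`): evasion (i) — rank is a theorem on the family (explicit points + `2`-descent,
Zywina), the `5`-descent is an upper Selmer bound per member; nothing here asserts `r_an`.
References: D. Zywina, arXiv:2502.01957; B. Perrin-Riou / P. Schneider (1985); Burungale–Castella–Skinner (2025);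
T. Tao–T. Ziegler, Acta Math. 201 (2008); J. Silverman, AEC X.4.2.
-/

-- D-0017: single-problem summit, so `Summit.BirchSwinnertonDyer.BirchSwinnertonDyer.…` repeats a namespace BY DESIGN.
set_option linter.dupNamespace false

noncomputable section

namespace Summit.BirchSwinnertonDyer.BirchSwinnertonDyer.Theorems.ShaPrimaryTransferZywinaEqualityDoorKeys

open scoped MatrixGroups ModularForm
open CongruenceSubgroup
open Literature.NumberTheory.EllipticCurves Literature.NumberTheory.EllipticCurves.Zywina2025
  Literature.NumberTheory.EllipticCurves.ModularForms
open Literature.NumberTheory.Sieve (TaoZiegler2008_polynomialProgressions)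
open WeierstrassCurve
open Summit.BirchSwinnertonDyer.BirchSwinnertonDyer.Rank1Residual
open Summit.BirchSwinnertonDyer.Rank1Residual.Additive
open Summit.BirchSwinnertonDyer.BirchSwinnertonDyer.Theses.ShaPrimaryTransfer (FiniteShaComponentTransfer)
open Summit.BirchSwinnertonDyer.BirchSwinnertonDyer.Theorems.ShaPrimaryTransferGoodOrdinaryFive
open Summit.BirchSwinnertonDyer.BirchSwinnertonDyer.Theorems.ShaPrimaryTransferZywinaEqualityDoor
open Summit.BirchSwinnertonDyer.BirchSwinnertonDyer.Theorems.ShaPrimaryTransferZywinaEqualityDoorInfinite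
open Summit.BirchSwinnertonDyer.BirchSwinnertonDyer.Theorems.ShaPrimaryTransferZywinaEqualityDoorClasses
open Summit.BirchSwinnertonDyer.BirchSwinnertonDyer.Theorems.ShaPrimaryTransferZywinaEqualityDoorDescent

section Members

variable {m n : ℕ}

/-- **The descent key on the classes** (R* discharges Schneider): for `(m, n) ∈ zywinaClass 5 K m₁ M` (`0 < K`, `5 ∤ m₁`,
`5^K ∤ m₁⁴ − 1`, `7 ∣ M`), granting PRS 85 and BCS, `#Sel^{(5)}(E_{m,n}/ℚ) = 25 ⟹ ord_{T=0} L_5(E_{m,n},T) = 2`.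
CONDITIONAL on `h85`, `hMC`. [cite: BalakrishnanMullerStein2015, Thm. 1.7] [cite: BurungaleCastellaSkinner2025, Thm. 1.1.2 (a)]
[cite: Schneider1982, §1 (p-adic height pairing and regulator)] [cite: SilvermanAEC2009, Thm X.4.2] [cite: Zywina2025, Thm 1.2] -/
theorem order_eq_two_of_natCard_selmerGroup_five_of_mem_zywinaClass [Fact (Nat.Prime 5)]
    (h85 : Schneider1985_order_charGenerator) (hMC : burungale_castella_skinner_charIdeal_eq_padicLFunction)
    {K m₁ M : ℕ} (hK : 0 < K) (h5m₁ : ¬ 5 ∣ m₁) (hμ : ¬ (5 : ℤ) ^ K ∣ (m₁ : ℤ) ^ (5 - 1) - 1) (h7M : 7 ∣ M)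
    (hmn : (m, n) ∈ zywinaClass 5 K m₁ M) [(zywinaCurve m n).IsElliptic] [(zywinaCurve m n).IsGloballyMinimal]
    {N : ℕ} [NeZero N] {f : CuspForm (Gamma0 N) 2} (hf : IsNewformOf (zywinaCurve m n) f)
    (hSel : Nat.card ((zywinaCurve m n).selmerGroup (5 : ℕ)) = 5 ^ 2) :
    (padicLFunction f (unitRoot (zywinaCurve m n) 5 : ℚ_[5])).order = 2 :=
  order_eq_two_of_natCard_selmerGroup_five_zywinaCurve h85 hMC hmn.1 (seven_dvd_of_mem_zywinaClass h7M hmn)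
    (schneiderConjecture_five_of_mem_zywinaClass hK h5m₁ hμ hmn) hf hSel

/-- **ALL KEYS on a class member**, granting only PRS 85 and BCS: the window `2 ≤ ord L_5`, the door `ord L_5 = 2 ⟺ Ш[5^∞]`
finite, the descent window `25 ∣ #Sel^{(5)}` and the descent key `#Sel^{(5)} = 25 ⟹ Ш[5^∞] = 0 ∧ ord L_5 = 2`.
CONDITIONAL on `h85`, `hMC`. [cite: BalakrishnanMullerStein2015, Thm. 1.7] [cite: BurungaleCastellaSkinner2025, Thm. 1.1.2 (a)]
[cite: Schneider1982, §1 (p-adic height pairing and regulator)] [cite: SilvermanAEC2009, Thm X.4.2] [cite: Zywina2025, Thm 1.2] -/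
theorem keys_five_of_mem_zywinaClass [Fact (Nat.Prime 5)]
    (h85 : Schneider1985_order_charGenerator) (hMC : burungale_castella_skinner_charIdeal_eq_padicLFunction)
    {K m₁ M : ℕ} (hK : 0 < K) (h5m₁ : ¬ 5 ∣ m₁) (hμ : ¬ (5 : ℤ) ^ K ∣ (m₁ : ℤ) ^ (5 - 1) - 1) (h7M : 7 ∣ M)
    (hmn : (m, n) ∈ zywinaClass 5 K m₁ M) [(zywinaCurve m n).IsElliptic] [(zywinaCurve m n).IsGloballyMinimal]
    {N : ℕ} [NeZero N] {f : CuspForm (Gamma0 N) 2} (hf : IsNewformOf (zywinaCurve m n) f) :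
    (2 : ℕ∞) ≤ (padicLFunction f (unitRoot (zywinaCurve m n) 5 : ℚ_[5])).order ∧
      ((padicLFunction f (unitRoot (zywinaCurve m n) 5 : ℚ_[5])).order = 2 ↔
        Finite (AddCommGroup.primaryComponent (zywinaCurve m n).sha 5)) ∧
      5 ^ 2 ∣ Nat.card ((zywinaCurve m n).selmerGroup (5 : ℕ)) ∧
      (Nat.card ((zywinaCurve m n).selmerGroup (5 : ℕ)) = 5 ^ 2 →
        AddCommGroup.primaryComponent (zywinaCurve m n).sha 5 = ⊥ ∧
          (padicLFunction f (unitRoot (zywinaCurve m n) 5 : ℚ_[5])).order = 2) := by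
  obtain ⟨hle, hdoor, -⟩ := window_and_door_five_of_mem_zywinaClass h85 hMC hK h5m₁ hμ h7M hmn hf
  exact ⟨hle, hdoor, sq_dvd_natCard_selmerGroup_zywinaCurve hmn.1 (by norm_num) (by norm_num), fun hSel ↦
    ⟨(shaCorank_eq_zero_of_natCard_selmerGroup_zywinaCurve hmn.1 5 (by norm_num) hSel).1,
      order_eq_two_of_natCard_selmerGroup_five_of_mem_zywinaClass h85 hMC hK h5m₁ hμ h7M hmn hf hSel⟩⟩

/-- **The residual gap in one line**: on a class member, granting PRS 85 and BCS, STRICT inequality `2 < ord L_5(E_{m,n})`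
holds iff `Ш(E_{m,n})[5^∞]` is infinite — and then every `5`-descent shows `#Sel^{(5)} > 25` (contrapositive of the descent
key). CONDITIONAL on `h85`, `hMC`. [cite: BalakrishnanMullerStein2015, Thm. 1.7] [cite: BurungaleCastellaSkinner2025, Thm. 1.1.2 (a)]
[cite: SilvermanAEC2009, Thm X.4.2] -/
theorem two_lt_order_iff_of_mem_zywinaClass [Fact (Nat.Prime 5)]
    (h85 : Schneider1985_order_charGenerator) (hMC : burungale_castella_skinner_charIdeal_eq_padicLFunction)
    {K m₁ M : ℕ} (hK : 0 < K) (h5m₁ : ¬ 5 ∣ m₁) (hμ : ¬ (5 : ℤ) ^ K ∣ (m₁ : ℤ) ^ (5 - 1) - 1) (h7M : 7 ∣ M)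
    (hmn : (m, n) ∈ zywinaClass 5 K m₁ M) [(zywinaCurve m n).IsElliptic] [(zywinaCurve m n).IsGloballyMinimal]
    {N : ℕ} [NeZero N] {f : CuspForm (Gamma0 N) 2} (hf : IsNewformOf (zywinaCurve m n) f) :
    ((2 : ℕ∞) < (padicLFunction f (unitRoot (zywinaCurve m n) 5 : ℚ_[5])).order ↔
        ¬ Finite (AddCommGroup.primaryComponent (zywinaCurve m n).sha 5)) ∧
      ((2 : ℕ∞) < (padicLFunction f (unitRoot (zywinaCurve m n) 5 : ℚ_[5])).order →
        Nat.card ((zywinaCurve m n).selmerGroup (5 : ℕ)) ≠ 5 ^ 2) := by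
  obtain ⟨-, -, hstrict⟩ := window_and_door_five_of_mem_zywinaClass h85 hMC hK h5m₁ hμ h7M hmn hf
  refine ⟨hstrict, fun hlt hSel ↦ ?_⟩
  have h2 := order_eq_two_of_natCard_selmerGroup_five_of_mem_zywinaClass h85 hMC hK h5m₁ hμ h7M hmn hf hSel
  rw [h2] at hlt
  exact lt_irrefl _ hlt

end Members

/-! ## On the infinite class `zywinaClass 5 2 11 7` (mod Tao–Ziegler) -/

section Infinite

/-- **ALL KEYS on infinitely many isomorphism classes of rank-2 curves** (mod `hTZ`, `h85`, `hMC`): infinitely many `j(E)`,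
`E/ℚ` of rank `2`, `5` good ordinary, `E[5]` irreducible, Schneider's conjecture at `5` (THEOREM R*), `25 ∣ #Sel^{(5)}(E/ℚ)`,
`#Sel^{(5)} = 25 ⟹ Ш(E)[5^∞] = 0`, and for every newform `f` of `E`: `2 ≤ ord_{T=0} L_5(E,T)`,
`ord L_5 = 2 ⟺ Ш(E)[5^∞]` finite, `#Sel^{(5)} = 25 ⟹ ord L_5 = 2`. CONDITIONAL on `hTZ`, `h85`, `hMC`.
[cite: Zywina2025, Thm 1.1 and Thm 1.2] [cite: TaoZiegler2008, Thm. 1.3] [cite: BalakrishnanMullerStein2015, Thm. 1.7]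
[cite: BurungaleCastellaSkinner2025, Thm. 1.1.2 (a)] [cite: Schneider1982, §1 (p-adic height pairing and regulator)]
[cite: SilvermanAEC2009, Thm X.4.2] -/
theorem infinite_setOf_j_rankTwo_keys_five [Fact (Nat.Prime 5)] (hTZ : TaoZiegler2008_polynomialProgressions)
    (h85 : Schneider1985_order_charGenerator) (hMC : burungale_castella_skinner_charIdeal_eq_padicLFunction) :
    {j : ℚ | ∃ (W : WeierstrassCurve ℚ) (hW : W.IsElliptic) (_ : W.IsGloballyMinimal),
      @WeierstrassCurve.j _ _ W hW = j ∧ W.mordellWeilRank = 2 ∧ W.HasGoodReductionAtPrime 5 ∧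
      ¬ ((5 : ℕ) : ℤ) ∣ W.frobeniusTrace 5 ∧ W.HasIrreducibleModPGaloisRep 5 ∧
      (∀ D : PAdicHeightData W 5, D.IsCanonical → SchneiderConjecture D) ∧
      5 ^ 2 ∣ Nat.card (W.selmerGroup (5 : ℕ)) ∧
      (Nat.card (W.selmerGroup (5 : ℕ)) = 5 ^ 2 → AddCommGroup.primaryComponent W.sha 5 = ⊥) ∧
      ∀ {N : ℕ} [NeZero N] (f : CuspForm (Gamma0 N) 2), IsNewformOf W f →
        (2 : ℕ∞) ≤ (padicLFunction f (unitRoot W 5 : ℚ_[5])).order ∧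
        ((padicLFunction f (unitRoot W 5 : ℚ_[5])).order = 2 ↔ Finite (AddCommGroup.primaryComponent W.sha 5)) ∧
        (Nat.card (W.selmerGroup (5 : ℕ)) = 5 ^ 2 → (padicLFunction f (unitRoot W 5 : ℚ_[5])).order = 2)}.Infinite := by
  have hsub : zywinaClass 5 2 11 7 ⊆ {mn : ℕ × ℕ | ZywinaAdmissible mn.1 mn.2 ∧ 7 ∣ mn.2} := by
    rintro ⟨a, b⟩ hq
    exact ⟨hq.1, seven_dvd_of_mem_zywinaClass (dvd_refl 7) hq⟩
  refine Set.infinite_of_injOn_mapsTo (injOn_j_admissible_seven.mono hsub) ?_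
    (zywinaClass_five_two_eleven_seven_infinite hTZ)
  rintro ⟨m, n⟩ hq
  have hq' : ZywinaAdmissible m n := hq.1
  haveI := isElliptic_zywinaCurve hq'
  haveI := isGloballyMinimal_zywinaCurve hq'
  obtain ⟨hgood, hord⟩ := goodOrdinary_five_zywinaCurve hq'
  have h7 : 7 ∣ n := seven_dvd_of_mem_zywinaClass (dvd_refl 7) hq
  have hR : ∀ D : PAdicHeightData (zywinaCurve m n) 5, D.IsCanonical → SchneiderConjecture D :=
    schneiderConjecture_five_of_mem_zywinaClass (K := 2) (m₁ := 11) (M := 7) (by norm_num) (by norm_num) (by decide) hq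
  refine ⟨zywinaCurve m n, isElliptic_zywinaCurve hq', isGloballyMinimal_zywinaCurve hq', by simp only [dif_pos hq'],
    mordellWeilRank_zywinaCurve hq', hgood, hord, hasIrreducibleModPGaloisRep_five_zywinaCurve hq' h7, hR,
    sq_dvd_natCard_selmerGroup_zywinaCurve hq' (by norm_num) (by norm_num),
    fun hSel ↦ (shaCorank_eq_zero_of_natCard_selmerGroup_zywinaCurve hq' 5 (by norm_num) hSel).1,
    fun f hf ↦ ?_⟩
  obtain ⟨hle, hdoor, -, hkey⟩ := keys_five_of_mem_zywinaClass h85 hMC (K := 2) (m₁ := 11) (M := 7)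
    (by norm_num) (by norm_num) (by decide) (dvd_refl 7) hq hf
  exact ⟨hle, hdoor, fun hSel ↦ (hkey hSel).2⟩

/-- **The brief's bottom line as one kernel theorem** (mod `hTZ`, `h85`, `hMC`): there are infinitely many `j`-invariants of
curves `E/ℚ` with `rank E(ℚ) = 2 ≤ ord_{T=0} L_5(E,T)` for every newform of `E`, with EQUALITY iff `Ш(E)[5^∞]` is finite.
CONDITIONAL on `hTZ`, `h85`, `hMC`. [cite: Zywina2025, Thm 1.1 and Thm 1.2] [cite: TaoZiegler2008, Thm. 1.3]
[cite: BalakrishnanMullerStein2015, Thm. 1.7] [cite: BurungaleCastellaSkinner2025, Thm. 1.1.2 (a)] -/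
theorem infinite_setOf_j_rank_le_order_with_equality_iff [Fact (Nat.Prime 5)]
    (hTZ : TaoZiegler2008_polynomialProgressions) (h85 : Schneider1985_order_charGenerator)
    (hMC : burungale_castella_skinner_charIdeal_eq_padicLFunction) :
    {j : ℚ | ∃ (W : WeierstrassCurve ℚ) (hW : W.IsElliptic) (_ : W.IsGloballyMinimal),
      @WeierstrassCurve.j _ _ W hW = j ∧ W.mordellWeilRank = 2 ∧
      ∀ {N : ℕ} [NeZero N] (f : CuspForm (Gamma0 N) 2), IsNewformOf W f →
        (W.mordellWeilRank : ℕ∞) ≤ (padicLFunction f (unitRoot W 5 : ℚ_[5])).order ∧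
        ((padicLFunction f (unitRoot W 5 : ℚ_[5])).order = W.mordellWeilRank ↔
          Finite (AddCommGroup.primaryComponent W.sha 5))}.Infinite := by
  refine (infinite_setOf_j_rankTwo_keys_five hTZ h85 hMC).mono ?_
  rintro j ⟨W, hW, hmin, hj, hrank, -, -, -, -, -, -, hkeys⟩
  refine ⟨W, hW, hmin, hj, hrank, fun f hf ↦ ?_⟩
  obtain ⟨hle, hdoor, -⟩ := hkeys f hf
  rw [hrank]
  exact ⟨hle, hdoor⟩

end Infinite

end Summit.BirchSwinnertonDyer.BirchSwinnertonDyer.Theorems.ShaPrimaryTransferZywinaEqualityDoorKeys
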